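import Literature.NumberTheory.GaloisCohomology.Howard2004.InertFrobeniusRingClassProofs
import Literature.NumberTheory.GaloisRepresentations.HOneRestrictionOntoInvariantsFinite
import Literature.NumberTheory.EllipticCurves.HeegnerGeomBottomRelationProofs
import HarnessLib

/-!
# `K[ℓ]_λ/K_λ` is totally ramified at an inert prime `λ = (ℓ)` of an imaginary quadratic `K`:
# `Γ_{K_λ} = I_{K_λ} · (Γ_{K_λ} ∩ Γ_{K[ℓ]})` (proofs file)

Topic `NumberTheory/GaloisCohomology/Howard2004` (sequel to `InertFrobeniusRingClassProofs`: ONE Frobenius of `K_λ`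
lies in `I_{K_λ} · (Γ_{K_λ} ∩ Γ_{K[ℓ]})`; here: EVERY element does).  THEOREMS ONLY: no definition, no named
fact, no instance, no `sorry`.

B. Howard, *The Heegner point Kolyvagin system*, Compositio Math. 140 (2004) §1.2 (arXiv:1202.6340 p. 6 L84–95):
«Since `λ` splits completely in the Hilbert class field of `K`, the maximal `p`-subextension of the local extension
`K[ℓ]_λ/K_λ` … is a maximal totally tamely ramified abelian `p`-extension of `K_λ`»; Gross 1991 §3: «the prime `λ`
… splits completely in `K_1/K`», «`λ_1` is totally ramified in `K_ℓ`».  In Galois terms: the inertia group of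
`K_λ` surjects onto `Gal(K[ℓ]_λ/K_λ)`, i.e. **`Γ_{K_λ} = I_{K_λ} · (Γ_{K_λ} ∩ Γ_{K[ℓ]})`**.

* `isOpen_ringClassSubgroup`, `isOpen_localRingClassSubgroup`, `localRingClassSubgroup_normal` — `Γ_{K[ℓ]}` is an
  open normal subgroup of `Γ_K` (fixing subgroup of a finite Galois extension), hence so is `Γ_{K_λ} ∩ Γ_{K[ℓ]}`
  in `Γ_{K_λ}`;
* **`absInertia_sup_localRingClassSubgroup_eq_top`** — `I_{K_λ} ⊔ (Γ_{K_λ} ∩ Γ_{K[ℓ]}) = ⊤`: the subgroup is open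
  (contains the open `Γ_{K_λ} ∩ Γ_{K[ℓ]}`), contains `I_{K_λ}` and an arithmetic Frobenius
  (`exists_isFrobPow_one_and_inv_mul_mem_localRingClassSubgroup`), so its image in `Γ_{K_λ}/I_{K_λ}` is an open
  (hence closed) subgroup containing the dense `⟨Frob⟩` (tree `dense_zpowers_mk_absInertia_of_isFrobPow`), i.e.
  everything;
* **`exists_mem_absInertia_inv_mul_mem_localRingClassSubgroup`** — `∀ σ ∈ Γ_{K_λ}, ∃ τ ∈ I_{K_λ}, τ⁻¹σ ∈
  Γ_{K_λ} ∩ Γ_{K[ℓ]}` — VERBATIM the hypothesis `htot` of `TransverseUnramifiedDisjointProofs` (∀σ form), and the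
  input of the complement half of Prop. 1.1.9 (`Γ_{K_λ}/(Γ_{K_λ} ∩ Γ_{K[ℓ]})` is the image of inertia).

Cell `pub/bsd-print-x9`, G87 = Howard 2004 Thm. 1.6.1 (print leaf `stub_h161` of stmt-BirchSwinnertonDyer-22642);
seat `bsd-line-x9-p1-w3` g14, brick (SPLIT-TOT).  BSD is not proved by any of this.

References: [Howard2004HeegnerKolyvagin] §1.2 (arXiv:1202.6340 p. 6 L84–95); [GrossLMS1991] §3, proof of Prop. 3.7;
[Cox2013] Thm. 11.1; [SerreLocalFields1979] XIII §1 (density of Frobenius powers in `Γ_F/I_F ≅ Ẑ`).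
-/

set_option autoImplicit false

noncomputable section

open scoped Classical NumberField Pointwise
open NumberField IsDedekindDomain IsDedekindDomain.HeightOneSpectrum Field Topology

namespace Literature.NumberTheory.GaloisCohomology.Howard2004

open Literature.NumberTheory.GaloisRepresentations
open Literature.NumberTheory.GaloisRepresentations.IsNonarchimedeanLocalField
open Literature.NumberTheory.EllipticCurves

variable {K : Type} [Field K] [NumberField K]

/-! ## §1 `Γ_{K[c]}` and `Γ_{K_λ} ∩ Γ_{K[c]}` are open normal subgroups -/

/-- **`Γ_{K[c]} = ringClassSubgroup K c jbar` is OPEN in `Γ_K`** (`K` imaginary quadratic, `c ≠ 0`): it is the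
fixing subgroup of a class-field copy `R ≅ K[c]` inside `K̄`, a finite extension of `K`.
[cite: Cox2013, Thm. 11.1] -/
theorem isOpen_ringClassSubgroup (hK : IsImaginaryQuadratic K) (jbar : AlgebraicClosure K →+* ℂ) {c : ℕ}
    (hc : c ≠ 0) : IsOpen (ringClassSubgroup K c jbar : Set (absoluteGaloisGroup K)) := by
  obtain ⟨R, hfd, -, -, -, ⟨e⟩⟩ :=
    exists_classField_algEquiv_ringClassField hK (jbar.comp (algebraMap K (AlgebraicClosure K))) hc
  haveI := hfd
  rw [ringClassSubgroup_eq_comap_fixingSubgroup hK jbar hc e]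
  exact IntermediateField.fixingSubgroup_isOpen R

/-- **`Γ_{K_λ} ∩ Γ_{K[c]} = localRingClassSubgroup c jbar λ` is OPEN in `Γ_{K_λ}`** (preimage of the open
`Γ_{K[c]}` under the continuous restriction `Γ_{K_λ} → Γ_K`). [cite: Cox2013, Thm. 11.1] -/
theorem isOpen_localRingClassSubgroup (hK : IsImaginaryQuadratic K) (jbar : AlgebraicClosure K →+* ℂ) {c : ℕ}
    (hc : c ≠ 0) (v : HeightOneSpectrum (𝓞 K)) :
    IsOpen (localRingClassSubgroup c jbar v : Set (absoluteGaloisGroup (v.adicCompletion K))) :=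
  (isOpen_ringClassSubgroup hK jbar hc).preimage (absGaloisRestrict K (v.adicCompletion K)).continuous

/-- `Γ_{K_λ} ∩ Γ_{K[c]}` is a NORMAL subgroup of `Γ_{K_λ}` (`K[c]/K` is Galois: `ringClassSubgroup_normal`).
[cite: Cox2013, Thm. 11.1 and Lemma 9.3] -/
theorem localRingClassSubgroup_normal (hK : IsImaginaryQuadratic K) (jbar : AlgebraicClosure K →+* ℂ)
    {c : ℕ} (hc : c ≠ 0) (v : HeightOneSpectrum (𝓞 K)) : (localRingClassSubgroup c jbar v).Normal := by
  haveI := ringClassSubgroup_normal hK jbar hc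
  exact Subgroup.Normal.comap inferInstance _

/-! ## §2 `Γ_{K_λ} = I_{K_λ} · (Γ_{K_λ} ∩ Γ_{K[ℓ]})` at an inert `λ = (ℓ)` -/

/-- **`I_{K_λ} ⊔ (Γ_{K_λ} ∩ Γ_{K[ℓ]}) = Γ_{K_λ}`** (`K` imaginary quadratic, `(ℓ)` an inert rational prime,
`λ ∋ ℓ`): «`K[ℓ]_λ/K_λ` is totally ramified» — the inertia group surjects onto `Gal(K[ℓ]_λ/K_λ)`.  Proof: the
subgroup `I ⊔ N` is open (⊇ the open `N`), contains `I` and an arithmetic Frobenius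
(`exists_isFrobPow_one_and_inv_mul_mem_localRingClassSubgroup`); its image in `Γ_{K_λ}/I` is an open, hence
closed, subgroup containing the dense subgroup generated by the Frobenius, so it is everything; and `I ⊔ N ⊇ I =
ker`.  [cite: GrossLMS1991, §3 (proof of Prop. 3.7 (2))] [cite: Howard2004HeegnerKolyvagin, §1.2 (arXiv:1202.6340 p. 6 L84–95)]
[cite: SerreLocalFields1979, XIII §1 Prop. 1] -/
theorem absInertia_sup_localRingClassSubgroup_eq_top (hK : IsImaginaryQuadratic K)
    (jbar : AlgebraicClosure K →+* ℂ) {ℓ : ℕ} (hℓ : ℓ.Prime) (hℓP : (Ideal.span {(ℓ : 𝓞 K)}).IsPrime)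
    {v : HeightOneSpectrum (𝓞 K)} (hv : (ℓ : 𝓞 K) ∈ v.asIdeal) :
    absInertia (v.adicCompletion K) ⊔ localRingClassSubgroup ℓ jbar v = ⊤ := by
  set I := absInertia (v.adicCompletion K) with hI_def
  set N := localRingClassSubgroup ℓ jbar v with hN_def
  haveI hIn : I.Normal := absInertia_normal_holds (v.adicCompletion K)
  -- a Frobenius in `I ⊔ N`
  obtain ⟨φ, hφ1, τ, hτ, hn⟩ := exists_isFrobPow_one_and_inv_mul_mem_localRingClassSubgroup hK jbar hℓ hℓP hv
  have hφmem : φ ∈ I ⊔ N := by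
    rw [show φ = τ * (τ⁻¹ * φ) by group]
    exact Subgroup.mul_mem _ (Subgroup.mem_sup_left hτ) (Subgroup.mem_sup_right hn)
  -- `I ⊔ N` is open
  have hNopen : IsOpen (N : Set (absoluteGaloisGroup (v.adicCompletion K))) :=
    isOpen_localRingClassSubgroup hK jbar hℓ.ne_zero v
  have hopen : IsOpen ((I ⊔ N : Subgroup (absoluteGaloisGroup (v.adicCompletion K))) :
      Set (absoluteGaloisGroup (v.adicCompletion K))) :=
    Subgroup.isOpen_mono (le_sup_right : N ≤ I ⊔ N) hNopen
  -- its image in `Γ/I` is open, closed and contains the dense `⟨φ̄⟩`, hence is everything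
  set π : absoluteGaloisGroup (v.adicCompletion K) →* absoluteGaloisGroup (v.adicCompletion K) ⧸ I :=
    QuotientGroup.mk' I with hπ_def
  have himg_open : IsOpen (((I ⊔ N).map π : Subgroup (absoluteGaloisGroup (v.adicCompletion K) ⧸ I)) :
      Set (absoluteGaloisGroup (v.adicCompletion K) ⧸ I)) := by
    rw [Subgroup.coe_map]
    exact QuotientGroup.isOpenMap_coe _ hopen
  have hclosed := Subgroup.isClosed_of_isOpen _ himg_open
  have hdense := dense_zpowers_mk_absInertia_of_isFrobPow (v.adicCompletion K) hφ1
  have hzp : (Subgroup.zpowers (QuotientGroup.mk φ : absoluteGaloisGroup (v.adicCompletion K) ⧸ I) :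
      Set (absoluteGaloisGroup (v.adicCompletion K) ⧸ I)) ⊆ (I ⊔ N).map π := by
    have h : Subgroup.zpowers (QuotientGroup.mk φ : absoluteGaloisGroup (v.adicCompletion K) ⧸ I) ≤
        (I ⊔ N).map π := (Subgroup.zpowers_le).2 (Subgroup.mem_map.2 ⟨φ, hφmem, rfl⟩)
    exact h
  have huniv : (((I ⊔ N).map π : Subgroup _) : Set (absoluteGaloisGroup (v.adicCompletion K) ⧸ I)) =
      Set.univ := by
    rw [← hclosed.closure_eq]
    exact (hdense.mono hzp).closure_eq
  have hmap : (I ⊔ N).map π = ⊤ := Subgroup.coe_eq_univ.1 huniv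
  -- pull back: `I ⊔ N ⊇ I = ker π`
  calc I ⊔ N = (I ⊔ N) ⊔ π.ker := by rw [hπ_def, QuotientGroup.ker_mk', sup_comm I N, sup_assoc, sup_idem]
    _ = (((I ⊔ N).map π).comap π) := (Subgroup.comap_map_eq π (I ⊔ N)).symm
    _ = ⊤ := by rw [hmap, Subgroup.comap_top]

/-- **Every `σ ∈ Γ_{K_λ}` is an inertia element times an element fixing `K[ℓ]`**: `∃ τ ∈ I_{K_λ}, τ⁻¹σ ∈
Γ_{K_λ} ∩ Γ_{K[ℓ]}` (`K` imaginary quadratic, `(ℓ)` inert, `λ ∋ ℓ`) — VERBATIM the hypothesis `htot` of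
`TransverseUnramifiedDisjointProofs.disjoint_unramifiedSubgroup_transverseCondition`.
[cite: GrossLMS1991, §3 (proof of Prop. 3.7 (2))] [cite: Howard2004HeegnerKolyvagin, §1.2 (arXiv:1202.6340 p. 6 L84–95)] -/
theorem exists_mem_absInertia_inv_mul_mem_localRingClassSubgroup (hK : IsImaginaryQuadratic K)
    (jbar : AlgebraicClosure K →+* ℂ) {ℓ : ℕ} (hℓ : ℓ.Prime) (hℓP : (Ideal.span {(ℓ : 𝓞 K)}).IsPrime)
    {v : HeightOneSpectrum (𝓞 K)} (hv : (ℓ : 𝓞 K) ∈ v.asIdeal)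
    (σ : absoluteGaloisGroup (v.adicCompletion K)) :
    ∃ τ ∈ absInertia (v.adicCompletion K), τ⁻¹ * σ ∈ localRingClassSubgroup ℓ jbar v := by
  haveI := localRingClassSubgroup_normal hK jbar hℓ.ne_zero v
  have hσ : σ ∈ ((absInertia (v.adicCompletion K) ⊔ localRingClassSubgroup ℓ jbar v :
      Subgroup (absoluteGaloisGroup (v.adicCompletion K))) : Set (absoluteGaloisGroup (v.adicCompletion K))) := by
    rw [absInertia_sup_localRingClassSubgroup_eq_top hK jbar hℓ hℓP hv]
    exact Set.mem_univ σ
  rw [Subgroup.mul_normal] at hσ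
  obtain ⟨τ, hτ, n, hn, rfl⟩ := Set.mem_mul.1 hσ
  exact ⟨τ, hτ, by rwa [inv_mul_cancel_left]⟩

end Literature.NumberTheory.GaloisCohomology.Howard2004

end
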